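/- Fleet lead `ym-wcr-19456-p1`, route `WeakCouplingRates`, crux `ColdBoxTwoPointFloorW` (stmt-QuantumFields-19608). -/
import Summits.QuantumFields.YangMills.Theorems.WeakCouplingRatesColdBoxForestGauge

/-!
# Crux `ColdBoxTwoPointFloor(W)`: the free edges of the Dirichlet Gaussian D1' and of the temporal-forest gauge fixing are the
# same — `DirFree H ≃ {e ∈ Λ // ¬ forest}`

The Dirichlet Gaussian `boxDirichlet H` (D1', `Theorems/WeakCouplingRatesDefs.lean`) is indexed by
`DirFree H = {e : ↥(boxEdgesAt dirCorner (2H+3)) // ¬ (e.1 ∉ dirFreeEdges H)}` (Chatterjee's `LatticeMaxwell.Free` on the enlarged box),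
while the gauge-fixed cold-wall box state (`integral_boxState_eq_coldFree`, file `…ColdBoxForestGaugeIntegral`) integrates over
`ColdFreeCfg H = {e : ↥Λ // ¬ forest e} → G`, `Λ = boxEdges 4 (2H+1)`.  This file identifies the two index types
(`dirFreeEquiv`), so that the one-scale comparison (stub `stub_boxDirichletDomination` / `stub_boxGaussianDomination`, step 5 of the
lead's plan) can put the `√(2β)`-rescaled chart coordinates of the free links and the Gaussian variables of D1' on the same index set:
* `boxEdges_subset_boxEdgesAt_dirCorner` — the cold box's edges are edges of the enlarged box `{−1,…,2H+1}⁴`;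
* `dirFreeEquiv H : DirFree H ≃ {e : ↥(boxEdges 4 (2H+1)) // ¬ (e.1.2 = 0 ∧ ∀ k, 1 ≤ e.1.1 k ∧ e.1.1 k + 1 ≤ 2H)}`, with
  `dirFreeEquiv_apply_coe` (the underlying edge is unchanged).
Everything proved; the only definition is the equivalence; standard axioms.
-/

set_option autoImplicit false

noncomputable section

open Finset Function
open Literature.MathematicalPhysics.QuantumFieldTheory
open Literature.MathematicalPhysics.QuantumFieldTheory.LatticeMaxwell
open Literature.MathematicalPhysics.QuantumFieldTheory.AxialGauge

namespace Summit.QuantumFields.YangMills.Theorems.WeakCouplingRates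

variable {H : ℕ}

/-- The edges of the cold box `{0,…,2H}⁴` are edges of the enlarged box `(−1,…,−1) + {0,…,2H+2}⁴`. -/
theorem boxEdges_subset_boxEdgesAt_dirCorner (H : ℕ) :
    boxEdges 4 (2 * H + 1) ⊆ boxEdgesAt dirCorner (2 * H + 3) := by
  intro e he
  obtain ⟨x, i⟩ := e
  rw [mem_boxEdgesAt, mem_boxEdges_iff]
  rw [mem_boxEdges_iff] at he
  refine ⟨fun k => ?_, ?_⟩
  · have := he.1 k
    simp only [Pi.sub_apply, dirCorner]
    push_cast; omega
  · have := he.2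
    simp only [Pi.sub_apply, dirCorner]
    push_cast; omega

variable (H) in
/-- **The free-edge index types of D1' and of the forest gauge fixing coincide.** -/
def dirFreeEquiv :
    DirFree H ≃ {e : ↥(boxEdges 4 (2 * H + 1)) // ¬ (e.1.2 = 0 ∧ ∀ k : Fin 4, 1 ≤ e.1.1 k ∧ e.1.1 k + 1 ≤ 2 * (H : ℤ))} where
  toFun e :=
    have h : e.1.1 ∈ dirFreeEdges H := not_not.1 e.2
    ⟨⟨e.1.1, (mem_dirFreeEdges.1 h).1⟩, by
      have h2 := (mem_dirFreeEdges.1 h).2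
      simpa using h2⟩
  invFun e :=
    ⟨⟨e.1.1, boxEdges_subset_boxEdgesAt_dirCorner H e.1.2⟩, not_not.2 (mem_dirFreeEdges.2 ⟨e.1.2, by
      have h2 := e.2
      simpa using h2⟩)⟩
  left_inv e := by ext <;> rfl
  right_inv e := by ext <;> rfl

/-- The equivalence does not move the underlying edge. -/
@[simp] theorem dirFreeEquiv_apply_coe (e : DirFree H) : ((dirFreeEquiv H e).1 : Literature.MathematicalPhysics.QuantumLattice.ZdEdge 4) = e.1.1 := rfl

/-- Nor does its inverse. -/
@[simp] theorem dirFreeEquiv_symm_apply_coe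
    (e : {e : ↥(boxEdges 4 (2 * H + 1)) // ¬ (e.1.2 = 0 ∧ ∀ k : Fin 4, 1 ≤ e.1.1 k ∧ e.1.1 k + 1 ≤ 2 * (H : ℤ))}) :
    (((dirFreeEquiv H).symm e).1 : Literature.MathematicalPhysics.QuantumLattice.ZdEdge 4) = e.1.1 := rfl

/-- Consequently the two index types have the same cardinality (the dimension of the Dirichlet Gaussian = the number of free links). -/
theorem card_dirFree_eq (H : ℕ) :
    Fintype.card (DirFree H) =
      Fintype.card {e : ↥(boxEdges 4 (2 * H + 1)) // ¬ (e.1.2 = 0 ∧ ∀ k : Fin 4, 1 ≤ e.1.1 k ∧ e.1.1 k + 1 ≤ 2 * (H : ℤ))} :=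
  Fintype.card_congr (dirFreeEquiv H)

end Summit.QuantumFields.YangMills.Theorems.WeakCouplingRates

end
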